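import Literature.Geometry.Lorentzian.CoordStarQuad
import HarnessLib

/-!
# Covariance of the component tensor calculus under changes of coordinates

Seventh layer of the rank-generic coordinate tensor calculus, towards Shi's derivative estimates
(Topping 2006, Thm. 3.3.1) on a *manifold*: the quantities `|∇^k Rm|²` computed in a chart do not
depend on the chart. For a smooth map `ψ : V' → V` between open sets of `E` with invertible
derivative (a change of coordinates) and metric components `G` on `V`, the pulled-back components
`pullMetric G ψ y = G(ψ y) ∘ (Dψ_y × Dψ_y)` are metric components on `V'`, and

* `chrAt_pullMetric` — **the transformation law of the Christoffel map**:
  `Dψ Γ'(X,Y) = Γ(Dψ X, Dψ Y) + D²ψ(X,Y)` (O'Neill 1983, Ch. 3, Prop. 3.13 ff. / the classical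
  inhomogeneous law `Γ' = Dψ⁻¹(Γ ∘ Dψ Dψ + D²ψ)`);
* `tpull b ψ T` — the pull-back of a covariant component field (`(ψ^*T)_I = T(Dψ b_{I_1}, …)`) and
  **`tcov_tpull` — `∇` commutes with pull-backs** (`∇'(ψ^*T) = ψ^*(∇T)`, O'Neill 1983, Ch. 3,
  Prop. 3.59: isometries preserve the Levi-Civita connection);
* **`rm4_pullMetric` — the curvature tensor is natural** (`R' = ψ^*R`, from the Ricci identity and
  `tcov_tpull`) and hence `curvD (pullMetric) k = ψ^* (curvD k)` for all `k`;
* **`tnormSq_tpull` — `|ψ^*T|²_{G'}(y) = |T|²_G(ψ y)`** (orthonormal frames correspond under `Dψ`);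
* consequently `tnormSq_curvD_pullMetric`: `|∇'^k Rm'|²(y) = |∇^k Rm|²(ψ y)` for every `k`.

Everything is proved; no definition of `Prop` type.

## References

* B. O'Neill, *Semi-Riemannian geometry with applications to relativity*, Academic Press 1983,
  Ch. 3, Prop. 3.13, Prop. 3.59–Cor. 3.61 (isometries preserve `∇`, `R`, and tensor norms). [ONeill1983]
* P. Topping, *Lectures on the Ricci flow*, LMS Lecture Note Series 325, CUP 2006, §1.2.3, §3.3.
  [Topping2006]
-/

noncomputable section

set_option maxSynthPendingDepth 3

open Set Filter ContinuousLinearMap Module Function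
open scoped Topology ContDiff

namespace Literature.Geometry.Lorentzian

namespace MetricCoord

variable {E : Type*} [NormedAddCommGroup E] [NormedSpace ℝ E] {ι : Type*}

/-! ### The pulled-back metric components -/

section Pull

variable (G : E → E →L[ℝ] E →L[ℝ] ℝ) (ψ : E → E)

/-- **Pulled-back metric components** `(ψ^*G)_y(v, w) = G_{ψ y}(Dψ_y v, Dψ_y w)`.
[cite: ONeill1983, Ch. 3, Def. 3.9 ff.] -/
def pullMetric (y : E) : E →L[ℝ] E →L[ℝ] ℝ :=
  (G (ψ y)).bilinearComp (fderiv ℝ ψ y) (fderiv ℝ ψ y)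

/-- Unfolding lemma for `pullMetric`. [cite: ONeill1983, Ch. 3, Def. 3.9 ff.] -/
@[simp] theorem pullMetric_apply (y v w : E) : pullMetric G ψ y v w = G (ψ y) (fderiv ℝ ψ y v) (fderiv ℝ ψ y w) := rfl

/-- `pullMetric` through `flipCLM` and `comp` (for smoothness). [folklore] -/
theorem pullMetric_eq_flip (y : E) :
    pullMetric G ψ y = flipCLM ((flipCLM ((G (ψ y)).comp (fderiv ℝ ψ y))).comp (fderiv ℝ ψ y)) := by
  ext v w
  simp [pullMetric, flipCLM_apply]

/-- **A change of coordinates**: `ψ` is `C^∞` on the open set `V'`, maps it into `V`, and has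
invertible derivative at every point of `V'`. [folklore] -/
structure IsCoordChangeOn (ψ : E → E) (V' V : Set E) : Prop where
  isOpen : IsOpen V'
  contDiffOn : ContDiffOn ℝ ∞ ψ V'
  mapsTo : MapsTo ψ V' V
  isInvertible : ∀ y ∈ V', (fderiv ℝ ψ y).IsInvertible

variable {G ψ} {V V' : Set E} {y : E}

namespace IsCoordChangeOn

/-- `ψ` is `C^∞` at the points of `V'`. [folklore] -/
theorem contDiffAt (hψ : IsCoordChangeOn ψ V' V) (hy : y ∈ V') : ContDiffAt ℝ ∞ ψ y :=
  (hψ.contDiffOn y hy).contDiffAt (hψ.isOpen.mem_nhds hy)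

/-- `ψ` is differentiable at the points of `V'`. [folklore] -/
theorem differentiableAt (hψ : IsCoordChangeOn ψ V' V) (hy : y ∈ V') : DifferentiableAt ℝ ψ y :=
  (hψ.contDiffAt hy).differentiableAt (by simp)

/-- `Dψ` is `C^∞` on `V'`. [folklore] -/
theorem contDiffOn_fderiv (hψ : IsCoordChangeOn ψ V' V) : ContDiffOn ℝ ∞ (fderiv ℝ ψ) V' :=
  hψ.contDiffOn.fderiv_of_isOpen hψ.isOpen (by simp)

/-- `Dψ` is differentiable at the points of `V'`. [folklore] -/
theorem differentiableAt_fderiv (hψ : IsCoordChangeOn ψ V' V) (hy : y ∈ V') :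
    DifferentiableAt ℝ (fderiv ℝ ψ) y :=
  ((hψ.contDiffOn_fderiv y hy).contDiffAt (hψ.isOpen.mem_nhds hy)).differentiableAt (by simp)

/-- `D²ψ` is symmetric at the points of `V'`. [folklore] -/
theorem fderiv_fderiv_comm (hψ : IsCoordChangeOn ψ V' V) (hy : y ∈ V') (u v : E) :
    fderiv ℝ (fderiv ℝ ψ) y u v = fderiv ℝ (fderiv ℝ ψ) y v u :=
  (hψ.contDiffAt hy).isSymmSndFDerivAt two_le_infty u v

/-- `Dψ_y` is surjective at the points of `V'`. [folklore] -/
theorem surjective (hψ : IsCoordChangeOn ψ V' V) (hy : y ∈ V') : Surjective (fderiv ℝ ψ y) := by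
  obtain ⟨e, he⟩ := hψ.isInvertible y hy
  rw [← he]
  exact e.surjective

/-- `Dψ_y` is injective at the points of `V'`. [folklore] -/
theorem injective (hψ : IsCoordChangeOn ψ V' V) (hy : y ∈ V') : Injective (fderiv ℝ ψ y) := by
  obtain ⟨e, he⟩ := hψ.isInvertible y hy
  rw [← he]
  exact e.injective

end IsCoordChangeOn

/-- **The pulled-back components are metric components** on `V'`. [cite: ONeill1983, Ch. 3, Def. 3.9 ff.] -/
theorem IsMetricOn.isMetricOn_pullMetric [FiniteDimensional ℝ E] (hG : IsMetricOn G V) (hψ : IsCoordChangeOn ψ V' V) :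
    IsMetricOn (pullMetric G ψ) V' where
  isOpen := hψ.isOpen
  contDiffOn := by
    have hGψ : ContDiffOn ℝ ∞ (fun y ↦ G (ψ y)) V' := hG.contDiffOn.comp hψ.contDiffOn hψ.mapsTo
    have hD := hψ.contDiffOn_fderiv
    have h1 : ContDiffOn ℝ ∞ (fun y ↦ (G (ψ y)).comp (fderiv ℝ ψ y)) V' := hGψ.clm_comp hD
    have h2 : ContDiffOn ℝ ∞ (fun y ↦ flipCLM ((G (ψ y)).comp (fderiv ℝ ψ y))) V' :=
      flipCLM.contDiff.comp_contDiffOn h1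
    have h3 := flipCLM.contDiff.comp_contDiffOn (h2.clm_comp hD)
    refine h3.congr fun y _ ↦ ?_
    exact pullMetric_eq_flip G ψ y
  symm y hy v w := by
    rw [pullMetric_apply, pullMetric_apply, hG.symm _ (hψ.mapsTo hy)]
  isInvertible y hy := by
    refine isInvertible_of_nondegenerate fun v hv ↦ ?_
    have hGi := hG.isInvertible _ (hψ.mapsTo hy)
    have h1 : G (ψ y) (fderiv ℝ ψ y v) = 0 := by
      ext w
      obtain ⟨w', rfl⟩ := hψ.surjective hy w
      simpa using hv w'
    have h2 : fderiv ℝ ψ y v = 0 := by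
      obtain ⟨e, he⟩ := hGi
      have : e (fderiv ℝ ψ y v) = 0 := by rw [← he] at h1; exact_mod_cast h1
      exact (map_eq_zero_iff e e.injective).mp this
    exact (map_eq_zero_iff _ (hψ.injective hy)).mp h2

end Pull

/-! ### The transformation law of the Christoffel map -/

section ChrLaw

variable {G : E → E →L[ℝ] E →L[ℝ] ℝ} {ψ : E → E} {V V' : Set E} {y : E} [FiniteDimensional ℝ E]

/-- **The derivative of the pulled-back components**:
`∂_X (ψ^*G)(Y,Z) = (∂_{DψX}G)(DψY, DψZ) + G(D²ψ(X,Y), DψZ) + G(DψY, D²ψ(X,Z))`. [folklore] -/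
theorem IsMetricOn.fderiv_pullMetric (hG : IsMetricOn G V) (hψ : IsCoordChangeOn ψ V' V) (hy : y ∈ V')
    (X Y Z : E) :
    fderiv ℝ (pullMetric G ψ) y X Y Z =
      fderiv ℝ G (ψ y) (fderiv ℝ ψ y X) (fderiv ℝ ψ y Y) (fderiv ℝ ψ y Z)
        + G (ψ y) (fderiv ℝ (fderiv ℝ ψ) y X Y) (fderiv ℝ ψ y Z)
        + G (ψ y) (fderiv ℝ ψ y Y) (fderiv ℝ (fderiv ℝ ψ) y X Z) := by
  have hG' := hG.isMetricOn_pullMetric hψ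
  rw [← hG'.fderiv_apply₂ hy]
  -- the three factors
  have hx : ψ y ∈ V := hψ.mapsTo hy
  have hc : HasFDerivAt (fun y' ↦ G (ψ y')) ((fderiv ℝ G (ψ y)).comp (fderiv ℝ ψ y)) y :=
    (hG.differentiableAt hx).hasFDerivAt.comp y (hψ.differentiableAt hy).hasFDerivAt
  have hu : HasFDerivAt (fun y' ↦ fderiv ℝ ψ y' Y) ((fderiv ℝ (fderiv ℝ ψ) y).flip Y) y :=
    hasFDerivAt_clm_apply_const (hψ.differentiableAt_fderiv hy).hasFDerivAt Y
  have hw : HasFDerivAt (fun y' ↦ fderiv ℝ ψ y' Z) ((fderiv ℝ (fderiv ℝ ψ) y).flip Z) y :=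
    hasFDerivAt_clm_apply_const (hψ.differentiableAt_fderiv hy).hasFDerivAt Z
  have h := (hc.clm_apply hu).clm_apply hw
  have hfun : (fun y' ↦ pullMetric G ψ y' Y Z) = fun y' ↦ G (ψ y') (fderiv ℝ ψ y' Y) (fderiv ℝ ψ y' Z) := rfl
  rw [hfun, h.fderiv]
  simp only [_root_.add_apply, ContinuousLinearMap.comp_apply, ContinuousLinearMap.flip_apply]
  ring

/-- **The Koszul form of the pulled-back components**:
`K'(X,Y,Z) = K(DψX, DψY, DψZ) + 2 G(D²ψ(X,Y), DψZ)`. [cite: ONeill1983, Ch. 3, Thm. 3.11 (Koszul formula)] -/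
theorem IsMetricOn.koszulCLM_pullMetric (hG : IsMetricOn G V) (hψ : IsCoordChangeOn ψ V' V) (hy : y ∈ V')
    (X Y Z : E) :
    koszulCLM (pullMetric G ψ) y X Y Z =
      koszulCLM G (ψ y) (fderiv ℝ ψ y X) (fderiv ℝ ψ y Y) (fderiv ℝ ψ y Z)
        + 2 * G (ψ y) (fderiv ℝ (fderiv ℝ ψ) y X Y) (fderiv ℝ ψ y Z) := by
  have hx : ψ y ∈ V := hψ.mapsTo hy
  have hs := hG.symm _ hx
  simp only [koszulCLM_apply, hG.fderiv_pullMetric hψ hy]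
  rw [hψ.fderiv_fderiv_comm hy Y X, hψ.fderiv_fderiv_comm hy Z X, hψ.fderiv_fderiv_comm hy Z Y,
    hs (fderiv ℝ ψ y Y) (fderiv ℝ (fderiv ℝ ψ) y X Z), hs (fderiv ℝ ψ y Z) (fderiv ℝ (fderiv ℝ ψ) y X Y),
    hs (fderiv ℝ ψ y X) (fderiv ℝ (fderiv ℝ ψ) y Y Z)]
  ring

/-- **The transformation law of the Christoffel map under a change of coordinates**:
`Dψ_y Γ'_y(X,Y) = Γ_{ψy}(Dψ X, Dψ Y) + D²ψ_y(X,Y)` (O'Neill 1983, Ch. 3, Prop. 3.13 and Prop. 3.59: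
the Levi-Civita connection is natural). [cite: ONeill1983, Ch. 3, Prop. 3.59] -/
theorem IsMetricOn.chrAt_pullMetric (hG : IsMetricOn G V) (hψ : IsCoordChangeOn ψ V' V) (hy : y ∈ V') (X Y : E) :
    fderiv ℝ ψ y (chrAt (pullMetric G ψ) y X Y) =
      chrAt G (ψ y) (fderiv ℝ ψ y X) (fderiv ℝ ψ y Y) + fderiv ℝ (fderiv ℝ ψ) y X Y := by
  have hG' := hG.isMetricOn_pullMetric hψ
  have hx : ψ y ∈ V := hψ.mapsTo hy
  have hGi := hG.isInvertible _ hx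
  -- pair with `Dψ Z` for every `Z`
  have hpair : ∀ Z, G (ψ y) (fderiv ℝ ψ y (chrAt (pullMetric G ψ) y X Y)) (fderiv ℝ ψ y Z) =
      G (ψ y) (chrAt G (ψ y) (fderiv ℝ ψ y X) (fderiv ℝ ψ y Y) + fderiv ℝ (fderiv ℝ ψ) y X Y) (fderiv ℝ ψ y Z) := by
    intro Z
    have h1 := two_mul_apply_chrAt (hG'.isInvertible y hy) X Y Z
    rw [pullMetric_apply, hG.koszulCLM_pullMetric hψ hy, ← two_mul_apply_chrAt hGi] at h1
    rw [map_add, _root_.add_apply]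
    linarith
  -- nondegeneracy
  have hall : ∀ w, G (ψ y) (fderiv ℝ ψ y (chrAt (pullMetric G ψ) y X Y)) w =
      G (ψ y) (chrAt G (ψ y) (fderiv ℝ ψ y X) (fderiv ℝ ψ y Y) + fderiv ℝ (fderiv ℝ ψ) y X Y) w := by
    intro w
    obtain ⟨Z, rfl⟩ := hψ.surjective hy w
    exact hpair Z
  have heq : G (ψ y) (fderiv ℝ ψ y (chrAt (pullMetric G ψ) y X Y)) =
      G (ψ y) (chrAt G (ψ y) (fderiv ℝ ψ y X) (fderiv ℝ ψ y Y) + fderiv ℝ (fderiv ℝ ψ) y X Y) := by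
    ext w; exact hall w
  obtain ⟨e, he⟩ := hGi
  have : e (fderiv ℝ ψ y (chrAt (pullMetric G ψ) y X Y)) =
      e (chrAt G (ψ y) (fderiv ℝ ψ y X) (fderiv ℝ ψ y Y) + fderiv ℝ (fderiv ℝ ψ) y X Y) := by
    rw [← he] at heq; exact_mod_cast heq
  exact e.injective this

end ChrLaw

/-! ### Pull-back of component fields; `∇` commutes with pull-backs -/

section TPull

variable [Fintype ι] (b : Basis ι ℝ E) {α β : Type*} [Fintype α] [DecidableEq α] [FiniteDimensional ℝ E]

/-- **Pull-back of a covariant component field along `ψ`**: `(ψ^*T)_I(y) = T_{ψ y}(Dψ b_{I_1}, …, Dψ b_{I_r})`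
(multilinear evaluation of the components of `T` at `ψ y` on the pushed-forward basis vectors).
[cite: ONeill1983, Ch. 3, Def. 3.9 ff.] -/
def tpull (ψ : E → E) (T : E → (α → ι) → ℝ) : E → (α → ι) → ℝ :=
  fun y I ↦ frameComp b (T (ψ y)) (fun a ↦ fderiv ℝ ψ y (b (I a)))

omit [FiniteDimensional ℝ E] in
/-- Unfolding lemma for `tpull`. [cite: ONeill1983, Ch. 3, Def. 3.9 ff.] -/
theorem tpull_apply (ψ : E → E) (T : E → (α → ι) → ℝ) (y : E) (I : α → ι) :
    tpull b ψ T y I = ∑ K : α → ι, (∏ a, b.coord (K a) (fderiv ℝ ψ y (b (I a)))) * T (ψ y) K := rfl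

variable {b} {G : E → E →L[ℝ] E →L[ℝ] ℝ} {ψ : E → E} {V V' : Set E} {y : E}

omit [FiniteDimensional ℝ E] in
/-- Relabelling commutes with pull-back. [folklore] -/
theorem tpull_treindex [Fintype β] [DecidableEq β] (e : α ≃ β) (ψ : E → E) (T : E → (α → ι) → ℝ) :
    tpull b ψ (treindex e T) = treindex e (tpull b ψ T) := by
  funext y J
  simp only [tpull_apply, treindex_apply]
  rw [← (e.arrowCongr (Equiv.refl ι)).symm.sum_comp]
  refine Finset.sum_congr rfl fun K _ ↦ ?_
  rw [← e.prod_comp]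
  rfl

omit [FiniteDimensional ℝ E] in
/-- Pull-back commutes with subtraction. [folklore] -/
theorem tpull_sub (ψ : E → E) (S T : E → (α → ι) → ℝ) (y : E) (I : α → ι) :
    tpull b ψ (S - T) y I = tpull b ψ S y I - tpull b ψ T y I := by
  simp only [tpull_apply, Pi.sub_apply, mul_sub, Finset.sum_sub_distrib]

/-- The pull-back of a smooth field is smooth on `V'`. [folklore] -/
theorem TSmoothOn.tpull {T : E → (α → ι) → ℝ} (hT : TSmoothOn T V) (hψ : IsCoordChangeOn ψ V' V) :
    TSmoothOn (tpull b ψ T) V' := by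
  intro I
  simp only [tpull_apply]
  refine ContDiffOn.sum fun K _ ↦ ContDiffOn.mul (contDiffOn_prod fun a _ ↦ ?_) ((hT K).comp hψ.contDiffOn hψ.mapsTo)
  exact (coordCLM b (K a)).contDiff.comp_contDiffOn (hψ.contDiffOn_fderiv.clm_apply contDiffOn_const)

omit [Fintype ι] in
/-- The derivative of `y ↦ bᵏ(Dψ_y v)` along `w` is `bᵏ(D²ψ_y(w, v))`. [folklore] -/
theorem IsCoordChangeOn.hasFDerivAt_coord_fderiv (hψ : IsCoordChangeOn ψ V' V) (hy : y ∈ V') (k : ι) (v : E) :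
    HasFDerivAt (fun y' ↦ b.coord k (fderiv ℝ ψ y' v))
      ((coordCLM b k).comp ((fderiv ℝ (fderiv ℝ ψ) y).flip v)) y := by
  have h1 := hasFDerivAt_clm_apply_const (hψ.differentiableAt_fderiv hy).hasFDerivAt v
  exact (coordCLM b k).hasFDerivAt.comp y h1

/-- **`∇` commutes with pull-backs**: `∇'(ψ^*T) = ψ^*(∇T)` for the pulled-back metric components
(O'Neill 1983, Ch. 3, Prop. 3.59: an isometry carries the Levi-Civita connection of one metric to
that of the other; here in components, from the transformation law of `Γ`).
[cite: ONeill1983, Ch. 3, Prop. 3.59] -/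
theorem IsMetricOn.tcov_tpull (hG : IsMetricOn G V) (hψ : IsCoordChangeOn ψ V' V) {T : E → (α → ι) → ℝ}
    (hT : TSmoothOn T V) (hy : y ∈ V') (J : Option α → ι) :
    tcov (pullMetric G ψ) b (tpull b ψ T) y J = tpull b ψ (tcov G b T) y J := by
  obtain ⟨j, I, rfl⟩ : ∃ j I, J = ocons j I := ⟨J none, J ∘ some, (ocons_eta J).symm⟩
  have hx : ψ y ∈ V := hψ.mapsTo hy
  have hV := hG.isOpen
  have hG' := hG.isMetricOn_pullMetric hψ
  -- the factors `f_{K,a}(y') = b^{K a}(Dψ_{y'} b_{I a})` and their derivatives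
  have hf : ∀ (K : α → ι) (a : α), HasFDerivAt (fun y' ↦ b.coord (K a) (fderiv ℝ ψ y' (b (I a))))
      ((coordCLM b (K a)).comp ((fderiv ℝ (fderiv ℝ ψ) y).flip (b (I a)))) y := fun K a ↦
    hψ.hasFDerivAt_coord_fderiv hy _ _
  have hP : ∀ K : α → ι, HasFDerivAt (fun y' ↦ ∏ a, b.coord (K a) (fderiv ℝ ψ y' (b (I a))))
      (∑ a, (∏ a' ∈ Finset.univ.erase a, b.coord (K a') (fderiv ℝ ψ y (b (I a')))) •
        (coordCLM b (K a)).comp ((fderiv ℝ (fderiv ℝ ψ) y).flip (b (I a)))) y := fun K ↦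
    HasFDerivAt.finsetProd fun a _ ↦ hf K a
  have hTψ : ∀ K : α → ι, HasFDerivAt (fun y' ↦ T (ψ y') K) ((fderiv ℝ (fun z ↦ T z K) (ψ y)).comp (fderiv ℝ ψ y)) y :=
    fun K ↦ (hT.differentiableAt hV hx K).hasFDerivAt.comp y (hψ.differentiableAt hy).hasFDerivAt
  -- Step 1: the derivative of `tpull T` along `b_j`
  have hDer : fderiv ℝ (fun y' ↦ tpull b ψ T y' I) y (b j) =
      ∑ K : α → ι, ((∑ a, (∏ a' ∈ Finset.univ.erase a, b.coord (K a') (fderiv ℝ ψ y (b (I a')))) *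
          b.coord (K a) (fderiv ℝ (fderiv ℝ ψ) y (b j) (b (I a)))) * T (ψ y) K
        + (∏ a, b.coord (K a) (fderiv ℝ ψ y (b (I a)))) * fderiv ℝ (fun z ↦ T z K) (ψ y) (fderiv ℝ ψ y (b j))) := by
    have hsum : HasFDerivAt (fun y' ↦ tpull b ψ T y' I)
        (∑ K : α → ι, ((∏ a, b.coord (K a) (fderiv ℝ ψ y (b (I a)))) • ((fderiv ℝ (fun z ↦ T z K) (ψ y)).comp (fderiv ℝ ψ y))
          + T (ψ y) K • (∑ a, (∏ a' ∈ Finset.univ.erase a, b.coord (K a') (fderiv ℝ ψ y (b (I a')))) •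
            (coordCLM b (K a)).comp ((fderiv ℝ (fderiv ℝ ψ) y).flip (b (I a)))))) y :=
      HasFDerivAt.fun_sum (u := Finset.univ) fun (K : α → ι) _ ↦ (hP K).mul (hTψ K)
    rw [hsum.fderiv, FunLike.coe_sum, Finset.sum_apply]
    refine Finset.sum_congr rfl fun K _ ↦ ?_
    simp only [_root_.add_apply, _root_.smul_apply, FunLike.coe_sum, Finset.sum_apply, smul_eq_mul,
      ContinuousLinearMap.comp_apply, ContinuousLinearMap.flip_apply, coordCLM_apply]
    rw [add_comm, mul_comm (T (ψ y) K)]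
  -- Step 2: the right-hand side
  have hR : tpull b ψ (tcov G b T) y (ocons j I) =
      ∑ k₀, ∑ K : α → ι, b.coord k₀ (fderiv ℝ ψ y (b j)) * (∏ a, b.coord (K a) (fderiv ℝ ψ y (b (I a)))) *
        (fderiv ℝ (fun z ↦ T z K) (ψ y) (b k₀)
          - ∑ a, ∑ m, chrCoef G b (ψ y) k₀ (K a) m * T (ψ y) (update K a m)) := by
    rw [tpull_apply, sum_optionIndex]
    refine Finset.sum_congr rfl fun k₀ _ ↦ Finset.sum_congr rfl fun K _ ↦ ?_
    rw [Fintype.prod_option, tcov_apply_ocons]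
    simp only [ocons_none, ocons_some]
  -- Step 3: the derivative term of the right-hand side, `Dψ b_j = Σ_{k₀} b^{k₀}(Dψ b_j) b_{k₀}`
  have hDT : ∀ K : α → ι, fderiv ℝ (fun z ↦ T z K) (ψ y) (fderiv ℝ ψ y (b j)) =
      ∑ k₀, b.coord k₀ (fderiv ℝ ψ y (b j)) * fderiv ℝ (fun z ↦ T z K) (ψ y) (b k₀) := by
    intro K
    conv_lhs => rw [← b.sum_repr (fderiv ℝ ψ y (b j))]
    rw [map_sum]
    exact Finset.sum_congr rfl fun k₀ _ ↦ by rw [map_smul, smul_eq_mul, Basis.coord_apply]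
  -- Step 4: the Christoffel term of the left-hand side through the transformation law
  have hΓ' : ∀ a m, tpull b ψ T y (update I a m) =
      ∑ K : α → ι, (b.coord (K a) (fderiv ℝ ψ y (b m)) *
        ∏ a' ∈ Finset.univ.erase a, b.coord (K a') (fderiv ℝ ψ y (b (I a')))) * T (ψ y) K := by
    intro a m
    rw [tpull_apply]
    refine Finset.sum_congr rfl fun K _ ↦ ?_
    rw [prod_update_left (fun i k ↦ b.coord k (fderiv ℝ ψ y (b i))) I K a m]
  have hlaw : ∀ (K : α → ι) (a : α), ∑ m, chrCoef (pullMetric G ψ) b y j (I a) m * b.coord (K a) (fderiv ℝ ψ y (b m)) =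
      b.coord (K a) (chrAt G (ψ y) (fderiv ℝ ψ y (b j)) (fderiv ℝ ψ y (b (I a))))
        + b.coord (K a) (fderiv ℝ (fderiv ℝ ψ) y (b j) (b (I a))) := by
    intro K a
    rw [← map_add, ← hG.chrAt_pullMetric hψ hy, chrAt_basis_eq_sum b y j (I a), map_sum, map_sum]
    exact Finset.sum_congr rfl fun m _ ↦ by rw [map_smul, map_smul, smul_eq_mul]
  have hL2 : ∑ a, ∑ m, chrCoef (pullMetric G ψ) b y j (I a) m * tpull b ψ T y (update I a m) =
      ∑ K : α → ι, ∑ a, (∏ a' ∈ Finset.univ.erase a, b.coord (K a') (fderiv ℝ ψ y (b (I a')))) *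
        (b.coord (K a) (chrAt G (ψ y) (fderiv ℝ ψ y (b j)) (fderiv ℝ ψ y (b (I a))))
          + b.coord (K a) (fderiv ℝ (fderiv ℝ ψ) y (b j) (b (I a)))) * T (ψ y) K := by
    simp only [hΓ', Finset.mul_sum, ← hlaw, Finset.sum_mul]
    rw [sum_comm₃' fun (a : α) (m : ι) (K : α → ι) ↦ chrCoef (pullMetric G ψ) b y j (I a) m *
      (b.coord (K a) (fderiv ℝ ψ y (b m)) * (∏ a' ∈ Finset.univ.erase a, b.coord (K a') (fderiv ℝ ψ y (b (I a')))) *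
        T (ψ y) K)]
    refine Finset.sum_congr rfl fun K _ ↦ Finset.sum_congr rfl fun a _ ↦ ?_
    exact Finset.sum_congr rfl fun m _ ↦ by ring
  -- Step 5: the Christoffel term of the right-hand side, re-summed
  have hR2 : ∀ k₀, ∑ K : α → ι, (∏ a, b.coord (K a) (fderiv ℝ ψ y (b (I a)))) *
      (∑ a, ∑ m, chrCoef G b (ψ y) k₀ (K a) m * T (ψ y) (update K a m)) =
      ∑ K : α → ι, ∑ a, (∏ a' ∈ Finset.univ.erase a, b.coord (K a') (fderiv ℝ ψ y (b (I a')))) *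
        (∑ c, b.coord c (fderiv ℝ ψ y (b (I a))) * chrCoef G b (ψ y) k₀ c (K a)) * T (ψ y) K := by
    intro k₀
    simp only [Finset.mul_sum]
    rw [Finset.sum_comm]
    conv_rhs => rw [Finset.sum_comm]
    refine Finset.sum_congr rfl fun a _ ↦ ?_
    rw [sum_sum_update_swap (fun (K : α → ι) (m : ι) ↦ (∏ a', b.coord (K a') (fderiv ℝ ψ y (b (I a')))) *
      (chrCoef G b (ψ y) k₀ (K a) m * T (ψ y) (update K a m))) a]
    refine Finset.sum_congr rfl fun K _ ↦ ?_
    simp only [update_self, update_idem, update_eq_self, Finset.sum_mul]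
    refine Finset.sum_congr rfl fun c _ ↦ ?_
    rw [prod_update_right (fun i k ↦ b.coord k (fderiv ℝ ψ y (b i))) I K a c]
    ring
  -- Step 6: bilinearity of `Γ`: `Σ_{k₀} Σ_c b^{k₀}(Dψ b_j) b^c(Dψ b_{I a}) Γ^{K a}_{k₀ c} = b^{K a}(Γ(Dψ b_j, Dψ b_{I a}))`
  have hbil : ∀ (K : α → ι) (a : α), ∑ k₀, b.coord k₀ (fderiv ℝ ψ y (b j)) *
      ∑ c, b.coord c (fderiv ℝ ψ y (b (I a))) * chrCoef G b (ψ y) k₀ c (K a) =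
      b.coord (K a) (chrAt G (ψ y) (fderiv ℝ ψ y (b j)) (fderiv ℝ ψ y (b (I a)))) := by
    intro K a
    conv_rhs => rw [← b.sum_repr (fderiv ℝ ψ y (b j)), ← b.sum_repr (fderiv ℝ ψ y (b (I a)))]
    simp only [map_sum, map_smul, _root_.sum_apply, _root_.smul_apply, smul_eq_mul, Finset.mul_sum, Basis.coord_apply]
    conv_rhs => rw [Finset.sum_comm]
    refine Finset.sum_congr rfl fun k₀ _ ↦ Finset.sum_congr rfl fun c _ ↦ ?_
    simp only [chrCoef, Basis.coord_apply]
    ring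
  -- assemble: both sides equal `Σ_K P_K ∂_{Dψ b_j}T_K − Σ_K Σ_a P'_{K,a} b^{K a}(Γ(Dψ b_j, Dψ b_{I a})) T_K`
  have hLHS : tcov (pullMetric G ψ) b (tpull b ψ T) y (ocons j I) =
      ∑ K : α → ι, (∏ a, b.coord (K a) (fderiv ℝ ψ y (b (I a)))) * fderiv ℝ (fun z ↦ T z K) (ψ y) (fderiv ℝ ψ y (b j))
        - ∑ K : α → ι, ∑ a, (∏ a' ∈ Finset.univ.erase a, b.coord (K a') (fderiv ℝ ψ y (b (I a')))) *
          b.coord (K a) (chrAt G (ψ y) (fderiv ℝ ψ y (b j)) (fderiv ℝ ψ y (b (I a)))) * T (ψ y) K := by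
    rw [tcov_apply_ocons, hDer, hL2, ← Finset.sum_sub_distrib, ← Finset.sum_sub_distrib]
    refine Finset.sum_congr rfl fun K _ ↦ ?_
    rw [Finset.sum_mul]
    simp only [mul_add, add_mul, Finset.sum_add_distrib]
    ring
  have hRHS : tpull b ψ (tcov G b T) y (ocons j I) =
      ∑ K : α → ι, (∏ a, b.coord (K a) (fderiv ℝ ψ y (b (I a)))) * fderiv ℝ (fun z ↦ T z K) (ψ y) (fderiv ℝ ψ y (b j))
        - ∑ K : α → ι, ∑ a, (∏ a' ∈ Finset.univ.erase a, b.coord (K a') (fderiv ℝ ψ y (b (I a')))) *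
          b.coord (K a) (chrAt G (ψ y) (fderiv ℝ ψ y (b j)) (fderiv ℝ ψ y (b (I a)))) * T (ψ y) K := by
    rw [hR]
    simp only [mul_sub, Finset.sum_sub_distrib]
    congr 1
    · rw [Finset.sum_comm]
      refine Finset.sum_congr rfl fun K _ ↦ ?_
      rw [hDT K, Finset.mul_sum]
      exact Finset.sum_congr rfl fun k₀ _ ↦ by ring
    · have hstep : ∀ k₀, ∑ K : α → ι, b.coord k₀ (fderiv ℝ ψ y (b j)) * (∏ a, b.coord (K a) (fderiv ℝ ψ y (b (I a)))) *
          (∑ a, ∑ m, chrCoef G b (ψ y) k₀ (K a) m * T (ψ y) (update K a m)) =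
          ∑ K : α → ι, ∑ a, b.coord k₀ (fderiv ℝ ψ y (b j)) *
            ((∏ a' ∈ Finset.univ.erase a, b.coord (K a') (fderiv ℝ ψ y (b (I a')))) *
              (∑ c, b.coord c (fderiv ℝ ψ y (b (I a))) * chrCoef G b (ψ y) k₀ c (K a)) * T (ψ y) K) := by
        intro k₀
        calc ∑ K : α → ι, b.coord k₀ (fderiv ℝ ψ y (b j)) * (∏ a, b.coord (K a) (fderiv ℝ ψ y (b (I a)))) *
              (∑ a, ∑ m, chrCoef G b (ψ y) k₀ (K a) m * T (ψ y) (update K a m))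
            = b.coord k₀ (fderiv ℝ ψ y (b j)) * ∑ K : α → ι, (∏ a, b.coord (K a) (fderiv ℝ ψ y (b (I a)))) *
                (∑ a, ∑ m, chrCoef G b (ψ y) k₀ (K a) m * T (ψ y) (update K a m)) := by
              rw [Finset.mul_sum]
              exact Finset.sum_congr rfl fun K _ ↦ by ring
          _ = b.coord k₀ (fderiv ℝ ψ y (b j)) * ∑ K : α → ι, ∑ a,
                (∏ a' ∈ Finset.univ.erase a, b.coord (K a') (fderiv ℝ ψ y (b (I a')))) *
                  (∑ c, b.coord c (fderiv ℝ ψ y (b (I a))) * chrCoef G b (ψ y) k₀ c (K a)) * T (ψ y) K := by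
              rw [hR2 k₀]
          _ = _ := by
              rw [Finset.mul_sum]
              exact Finset.sum_congr rfl fun K _ ↦ by rw [Finset.mul_sum]
      simp only [hstep]
      rw [← sum_comm₃' fun (K : α → ι) (a : α) (k₀ : ι) ↦ b.coord k₀ (fderiv ℝ ψ y (b j)) *
        ((∏ a' ∈ Finset.univ.erase a, b.coord (K a') (fderiv ℝ ψ y (b (I a')))) *
          (∑ c, b.coord c (fderiv ℝ ψ y (b (I a))) * chrCoef G b (ψ y) k₀ c (K a)) * T (ψ y) K)]
      refine Finset.sum_congr rfl fun K _ ↦ Finset.sum_congr rfl fun a _ ↦ ?_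
      rw [← hbil K a, Finset.mul_sum, Finset.sum_mul]
      exact Finset.sum_congr rfl fun k₀ _ ↦ by ring
  rw [hLHS, hRHS]

end TPull

/-! ### Naturality of the curvature tensor -/

section Curv

variable [Fintype ι] {b : Basis ι ℝ E} {G : E → E →L[ℝ] E →L[ℝ] ℝ} {ψ : E → E} {V V' : Set E} {y : E}
  [FiniteDimensional ℝ E] [CompleteSpace E] [DecidableEq ι]

omit [DecidableEq ι] in
/-- `tcov2Alt` commutes with pull-backs on `V'`. [cite: ONeill1983, Ch. 3, Prop. 3.59] -/
theorem IsMetricOn.tcov2Alt_tpull {α : Type*} [Fintype α] [DecidableEq α] (hG : IsMetricOn G V)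
    (hψ : IsCoordChangeOn ψ V' V) {T : E → (α → ι) → ℝ} (hT : TSmoothOn T V) (hy : y ∈ V')
    (J : Option (Option α) → ι) :
    tcov2Alt (pullMetric G ψ) b (tpull b ψ T) y J = tpull b ψ (tcov2Alt G b T) y J := by
  have hG' := hG.isMetricOn_pullMetric hψ
  have h1 : ∀ z ∈ V', ∀ K, tcov (pullMetric G ψ) b (tpull b ψ T) z K = tpull b ψ (tcov G b T) z K :=
    fun z hz K ↦ hG.tcov_tpull hψ hT hz K
  have h2 : ∀ K, tcov (pullMetric G ψ) b (tcov (pullMetric G ψ) b (tpull b ψ T)) y K =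
      tpull b ψ (tcov G b (tcov G b T)) y K := by
    intro K
    rw [tcov_congr hψ.isOpen h1 hy K, hG.tcov_tpull hψ (hG.tsmoothOn_tcov hT) hy K]
  simp only [tcov2Alt, Pi.sub_apply, treindex_apply, h2]
  rw [tpull_sub, tpull_treindex, treindex_apply]

/-- The coordinate covector field `δ^{m₀}` as a constant rank-one component field. [folklore] -/
def deltaField (m₀ : ι) : E → (Unit → ι) → ℝ := fun _ K ↦ if K () = m₀ then 1 else 0

omit [Fintype ι] [FiniteDimensional ℝ E] [CompleteSpace E] in
/-- `δ^{m₀}` is smooth. [folklore] -/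
theorem tsmoothOn_deltaField (m₀ : ι) (V : Set E) : TSmoothOn (deltaField (E := E) m₀) V :=
  fun _ ↦ contDiffOn_const

omit [FiniteDimensional ℝ E] [CompleteSpace E] [DecidableEq ι] in
/-- Sums over index functions on `Unit`. [folklore] -/
theorem sum_unitIndex {R : Type*} [AddCommMonoid R] (F : (Unit → ι) → R) :
    ∑ K : Unit → ι, F K = ∑ m, F (fun _ ↦ m) := by
  rw [← (Equiv.funUnique Unit ι).symm.sum_comp]
  rfl

/-- **The curvature endomorphism is natural under changes of coordinates**:
`Dψ (R'(b_j,b_k) b_i) = R(Dψ b_j, Dψ b_k)(Dψ b_i)` (O'Neill 1983, Ch. 3, Prop. 3.59 (2)), obtained from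
the Ricci identity for rank-one fields and `tcov2Alt_tpull`. [cite: ONeill1983, Ch. 3, Prop. 3.59] -/
theorem IsMetricOn.fderiv_riemAt_pullMetric (hG : IsMetricOn G V) (hψ : IsCoordChangeOn ψ V' V) (hy : y ∈ V')
    (j k i : ι) :
    fderiv ℝ ψ y (riemAt (pullMetric G ψ) y (b j) (b k) (b i)) =
      riemAt G (ψ y) (fderiv ℝ ψ y (b j)) (fderiv ℝ ψ y (b k)) (fderiv ℝ ψ y (b i)) := by
  have hG' := hG.isMetricOn_pullMetric hψ
  have hx : ψ y ∈ V := hψ.mapsTo hy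
  refine b.ext_elem fun m₀ ↦ ?_
  rw [← Basis.coord_apply, ← Basis.coord_apply]
  -- the pulled-back covector field `ψ^* δ^{m₀}`
  have hT' : ∀ m, tpull b ψ (deltaField m₀) y (fun _ : Unit ↦ m) = b.coord m₀ (fderiv ℝ ψ y (b m)) := by
    intro m
    rw [tpull_apply, sum_unitIndex]
    simp only [Fintype.prod_unique, deltaField, mul_ite, mul_one, mul_zero, Finset.sum_ite_eq',
      Finset.mem_univ, if_true]
  -- the Ricci identity for `ψ^* δ^{m₀}` on `V'`
  have hsm : TSmoothOn (tpull b ψ (deltaField m₀)) V' := (tsmoothOn_deltaField m₀ V).tpull hψ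
  have hRic' := hG'.tcov_tcov_antisymm (b := b) hsm hy j k (fun _ : Unit ↦ i)
  have hupd : ∀ m, update (fun _ : Unit ↦ i) () m = fun _ ↦ m := fun m ↦ by
    funext u; simp
  rw [Fintype.sum_unique] at hRic'
  simp only [PUnit.default_eq_unit, hupd, hT'] at hRic'
  -- the left-hand side: `b^{m₀}(Dψ R'(b_j,b_k)b_i) = Σ_m R'^m_{jki} b^{m₀}(Dψ b_m)`
  have hA : b.coord m₀ (fderiv ℝ ψ y (riemAt (pullMetric G ψ) y (b j) (b k) (b i))) =
      ∑ m, riemCoef (pullMetric G ψ) b y j k i m * b.coord m₀ (fderiv ℝ ψ y (b m)) := by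
    rw [riemAt_basis_eq_sum b y j k i, map_sum, map_sum]
    exact Finset.sum_congr rfl fun m _ ↦ by rw [map_smul, map_smul, smul_eq_mul]
  -- the right-hand side: trilinear expansion
  have hB : b.coord m₀ (riemAt G (ψ y) (fderiv ℝ ψ y (b j)) (fderiv ℝ ψ y (b k)) (fderiv ℝ ψ y (b i))) =
      ∑ p, ∑ q, ∑ r, b.coord p (fderiv ℝ ψ y (b i)) * (b.coord q (fderiv ℝ ψ y (b k)) *
        (b.coord r (fderiv ℝ ψ y (b j)) * riemCoef G b (ψ y) r q p m₀)) := by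
    conv_lhs => rw [← b.sum_repr (fderiv ℝ ψ y (b j)), ← b.sum_repr (fderiv ℝ ψ y (b k)),
      ← b.sum_repr (fderiv ℝ ψ y (b i)), ← riemCLM_apply]
    simp only [map_sum, map_smul, _root_.sum_apply, _root_.smul_apply, smul_eq_mul, riemCLM_apply, Finset.mul_sum,
      Basis.coord_apply]
    refine Finset.sum_congr rfl fun p _ ↦ Finset.sum_congr rfl fun q _ ↦ Finset.sum_congr rfl fun r _ ↦ ?_
    simp only [riemCoef, Basis.coord_apply]
  -- `tcov2Alt` of the pulled-back field through the pull-back of `tcov2Alt δ^{m₀}`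
  have hW := hG.tcov2Alt_tpull (b := b) hψ (tsmoothOn_deltaField m₀ V) hy (ocons j (ocons k fun _ : Unit ↦ i))
  rw [tcov2Alt_apply_ocons, hRic', tpull_apply] at hW
  -- evaluate the right-hand side of `hW`
  have hval : ∀ K : Option (Option Unit) → ι, tcov2Alt G b (deltaField m₀) (ψ y) K =
      -riemCoef G b (ψ y) (K none) (K (some none)) (K (some (some ()))) m₀ := by
    intro K
    rw [hG.tcov2Alt_eq (tsmoothOn_deltaField m₀ V) (ψ y) hx K, Fintype.sum_unique]
    simp only [PUnit.default_eq_unit, ricTerm, deltaField, update_self, mul_ite, mul_one,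
      mul_zero, Finset.sum_ite_eq', Finset.mem_univ, if_true]
  simp only [hval, sum_optionIndex, sum_unitIndex, Fintype.prod_option, Fintype.prod_unique, ocons_none,
    ocons_some, mul_neg, Finset.sum_neg_distrib, neg_inj] at hW
  rw [hA, hB, hW, sum_comm₃' fun (p q r : ι) ↦ b.coord p (fderiv ℝ ψ y (b j)) *
    (b.coord q (fderiv ℝ ψ y (b k)) * b.coord r (fderiv ℝ ψ y (b i))) * riemCoef G b (ψ y) p q r m₀]
  refine Finset.sum_congr rfl fun r _ ↦ ?_
  rw [Finset.sum_comm]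
  exact Finset.sum_congr rfl fun q _ ↦ Finset.sum_congr rfl fun p _ ↦ by ring

/-- **The lowered curvature tensor is natural**: `rm4 (ψ^*G) = ψ^*(rm4 G)` on `V'`
(O'Neill 1983, Ch. 3, Prop. 3.59 (2)). [cite: ONeill1983, Ch. 3, Prop. 3.59] -/
theorem IsMetricOn.rm4_pullMetric (hG : IsMetricOn G V) (hψ : IsCoordChangeOn ψ V' V) (hy : y ∈ V')
    (J : Fin 4 → ι) : rm4 (pullMetric G ψ) b y J = tpull b ψ (rm4 G b) y J := by
  rw [tpull, frameComp_rm4, rm4, pullMetric_apply, hG.fderiv_riemAt_pullMetric hψ hy]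

end Curv

/-! ### Invariance of the norm; pull-back of `∇^k Rm` -/

section Norm

variable [Fintype ι] [DecidableEq ι] {b : Basis ι ℝ E} {G : E → E →L[ℝ] E →L[ℝ] ℝ} {ψ : E → E} {V V' : Set E} {y : E}
  [FiniteDimensional ℝ E] {α : Type*} [Fintype α] [DecidableEq α]

/-- **`|ψ^*T|²_{ψ^*G}(y) = |T|²_G(ψ y)`** at positive definite points: a `G_{ψy}`-orthonormal frame `e`
pulls back to the `(ψ^*G)_y`-orthonormal frame `Dψ⁻¹ e`, on which `ψ^*T` has the same components as
`T` on `e` (O'Neill 1983, Ch. 3, Prop. 3.59 ff.: isometries preserve all metric contractions).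
[cite: ONeill1983, Ch. 3, Prop. 3.59] -/
theorem IsMetricOn.tnormSq_tpull (hG : IsMetricOn G V) (hψ : IsCoordChangeOn ψ V' V) (hy : y ∈ V')
    (hpos : ∀ v, v ≠ 0 → 0 < G (ψ y) v v) (T : E → (α → ι) → ℝ) :
    tnormSq (pullMetric G ψ) b (tpull b ψ T) y = tnormSq G b T (ψ y) := by
  have hx : ψ y ∈ V := hψ.mapsTo hy
  have hs := hG.symm _ hx
  have hG' := hG.isMetricOn_pullMetric hψ
  have hs' := hG'.symm y hy
  obtain ⟨e, he⟩ := exists_orthonormal_basis hs hpos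
  obtain ⟨D, hD⟩ := hψ.isInvertible y hy
  -- the pulled-back frame
  set e' : Basis (Fin (finrank ℝ E)) ℝ E := e.map D.symm.toLinearEquiv with he'def
  have he'D : ∀ c, fderiv ℝ ψ y (e' c) = e c := by
    intro c
    rw [he'def, Basis.map_apply, ← hD]
    exact D.apply_symm_apply (e c)
  have he' : ∀ c d, pullMetric G ψ y (e' c) (e' d) = if c = d then 1 else 0 := by
    intro c d
    rw [pullMetric_apply, he'D, he'D, he c d]
  rw [tnormSq_eq_sum_sq_frame b e' he' (hG'.isInvertible y hy) hs', tnormSq_eq_sum_sq_frame b e he (hG.isInvertible _ hx) hs]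
  refine Finset.sum_congr rfl fun K _ ↦ ?_
  congr 1
  -- the frame components agree
  have hexp : (e ∘ K : α → E) = fun a ↦ ∑ i, b.coord i (e' (K a)) • fderiv ℝ ψ y (b i) := by
    funext a
    simp only [Function.comp_apply]
    conv_lhs => rw [← he'D (K a), ← b.sum_repr (e' (K a))]
    rw [map_sum]
    exact Finset.sum_congr rfl fun i _ ↦ by rw [map_smul, Basis.coord_apply]
  rw [hexp, frameComp_sum_smul, frameComp_apply]
  rfl

omit [DecidableEq ι] in
/-- `|T|²` only depends on the components at the point. [folklore] -/
theorem tnormSq_congr_pt {G₀ : E → E →L[ℝ] E →L[ℝ] ℝ} {T T' : E → (α → ι) → ℝ} {x : E}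
    (h : ∀ I, T x I = T' x I) : tnormSq G₀ b T x = tnormSq G₀ b T' x := by
  simp only [tnormSq_eq, tinner_apply, h]

variable [CompleteSpace E]

omit [DecidableEq ι] in
/-- `∇^k Rm` of a single metric is smooth on `V`. [cite: Topping2006, §1.2.3] -/
theorem IsMetricOn.tsmoothOn_curvD {Gf : ℝ → E → E →L[ℝ] E →L[ℝ] ℝ} {s : ℝ} (hG : IsMetricOn (Gf s) V) (k : ℕ) :
    TSmoothOn (curvD Gf b k s) V := by
  induction k with
  | zero => exact hG.tsmoothOn_rm4 b
  | succ k ih => exact (hG.tsmoothOn_tcov ih).treindex _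

/-- **`∇^k Rm` is natural**: for the pulled-back family `s ↦ ψ^*(G s)`,
`curvD (ψ^*G) k s = ψ^*(curvD G k s)` on `V'`, for every `k` (induction: `rm4_pullMetric`,
`tcov_tpull`, `tpull_treindex`). [cite: ONeill1983, Ch. 3, Prop. 3.59] -/
theorem curvD_pullMetric {Gf : ℝ → E → E →L[ℝ] E →L[ℝ] ℝ} {s : ℝ} (hG : IsMetricOn (Gf s) V)
    (hψ : IsCoordChangeOn ψ V' V) (k : ℕ) :
    ∀ z ∈ V', ∀ I, curvD (fun s' ↦ pullMetric (Gf s') ψ) b k s z I = tpull b ψ (curvD Gf b k s) z I := by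
  induction k with
  | zero =>
    intro z hz I
    exact hG.rm4_pullMetric hψ hz I
  | succ k ih =>
    intro z hz I
    rw [curvD_succ, curvD_succ, treindex_apply, tcov_congr hψ.isOpen ih hz, hG.tcov_tpull hψ (hG.tsmoothOn_curvD k) hz,
      tpull_treindex, treindex_apply]

/-- **`|∇'^k Rm'|²(y) = |∇^k Rm|²(ψ y)`**: the quantities `|∇^kRm|²` computed from the pulled-back
components agree with those computed from the original components (chart independence of
Topping's `|∇^k Rm|²`). [cite: Topping2006, §3.3, Thm. 3.3.1] -/
theorem tnormSq_curvD_pullMetric {Gf : ℝ → E → E →L[ℝ] E →L[ℝ] ℝ} {s : ℝ} (hG : IsMetricOn (Gf s) V)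
    (hψ : IsCoordChangeOn ψ V' V) (hy : y ∈ V') (hpos : ∀ v, v ≠ 0 → 0 < Gf s (ψ y) v v) (k : ℕ) :
    tnormSq (pullMetric (Gf s) ψ) b (curvD (fun s' ↦ pullMetric (Gf s') ψ) b k s) y =
      tnormSq (Gf s) b (curvD Gf b k s) (ψ y) := by
  rw [tnormSq_congr_pt (b := b) fun I ↦ curvD_pullMetric hG hψ k y hy I]
  exact hG.tnormSq_tpull hψ hy hpos _

end Norm

/-! ### Locality: the component calculus only depends on the metric components near the point -/

section Local

variable [Fintype ι] {b : Basis ι ℝ E} {G G' : E → E →L[ℝ] E →L[ℝ] ℝ} {U : Set E} {x : E}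

omit [Fintype ι] in
/-- The Christoffel map at `x` only depends on the components near `x`. [folklore] -/
theorem chrAt_congr_of_eventuallyEq (h : G =ᶠ[𝓝 x] G') : chrAt G x = chrAt G' x := by
  have h0 : G x = G' x := h.eq_of_nhds
  have h1 : fderiv ℝ G x = fderiv ℝ G' x := h.fderiv_eq
  ext X Y
  have hk : koszulCLM G x = koszulCLM G' x := by
    ext A B C; simp only [koszulCLM_apply, h1]
  have hs : sharpAt G x = sharpAt G' x := by
    unfold sharpAt; rw [h0]
  rw [chrAt_apply, chrAt_apply, hk, hs]

omit [Fintype ι] in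
/-- The curvature map at `x` only depends on the components on an open set around `x`. [folklore] -/
theorem riemAt_congr_of_eqOn (hU : IsOpen U) (h : ∀ y ∈ U, G y = G' y) (hx : x ∈ U) :
    riemAt G x = riemAt G' x := by
  have hev : ∀ y ∈ U, G =ᶠ[𝓝 y] G' := fun y hy ↦
    Filter.eventually_of_mem (hU.mem_nhds hy) fun z hz ↦ h z hz
  have hchr : chrAt G =ᶠ[𝓝 x] chrAt G' :=
    Filter.eventually_of_mem (hU.mem_nhds hx) fun y hy ↦ chrAt_congr_of_eventuallyEq (hev y hy)
  ext X Y Z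
  simp only [riemAt_apply, hchr.fderiv_eq, chrAt_congr_of_eventuallyEq (hev x hx)]

omit [Fintype ι] in
/-- `rm4` at `x` only depends on the components on an open set around `x`. [folklore] -/
theorem rm4_congr_of_eqOn (hU : IsOpen U) (h : ∀ y ∈ U, G y = G' y) (hx : x ∈ U) (J : Fin 4 → ι) :
    rm4 G b x J = rm4 G' b x J := by
  simp only [rm4, riemAt_congr_of_eqOn hU h hx, h x hx]

variable {α : Type*} [Fintype α] [DecidableEq α]

/-- `∇T` at `x` only depends on the metric components and on `T` near `x`. [folklore] -/
theorem tcov_congr_of_eqOn (hU : IsOpen U) (hG : ∀ y ∈ U, G y = G' y) {T T' : E → (α → ι) → ℝ}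
    (hT : ∀ y ∈ U, ∀ I, T y I = T' y I) (hx : x ∈ U) (J : Option α → ι) :
    tcov G b T x J = tcov G' b T' x J := by
  have hev : G =ᶠ[𝓝 x] G' := Filter.eventually_of_mem (hU.mem_nhds hx) fun z hz ↦ hG z hz
  have hevT : (fun y ↦ T y (J ∘ some)) =ᶠ[𝓝 x] fun y ↦ T' y (J ∘ some) :=
    Filter.eventually_of_mem (hU.mem_nhds hx) fun z hz ↦ hT z hz _
  simp only [tcov_apply, hevT.fderiv_eq, chrCoef, chrAt_congr_of_eventuallyEq hev, hT x hx]

/-- **`∇^k Rm` at a point only depends on the metric components on an open set around it**: two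
families agreeing on the open set `U` (at all times) have the same `curvD k` on `U`. [folklore] -/
theorem curvD_congr_of_eqOn {Gf Gf' : ℝ → E → E →L[ℝ] E →L[ℝ] ℝ} (hU : IsOpen U)
    (h : ∀ s, ∀ y ∈ U, Gf s y = Gf' s y) (s : ℝ) (k : ℕ) :
    ∀ y ∈ U, ∀ I, curvD Gf b k s y I = curvD Gf' b k s y I := by
  induction k with
  | zero => exact fun y hy I ↦ rm4_congr_of_eqOn hU (h s) hy I
  | succ k ih =>
    intro y hy I
    rw [curvD_succ, curvD_succ, treindex_apply, treindex_apply]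
    exact tcov_congr_of_eqOn hU (h s) ih hy _

/-- `|∇^k Rm|²` at a point only depends on the metric components around it. [folklore] -/
theorem tnormSq_curvD_congr_of_eqOn [FiniteDimensional ℝ E] {Gf Gf' : ℝ → E → E →L[ℝ] E →L[ℝ] ℝ} (hU : IsOpen U)
    (h : ∀ s, ∀ y ∈ U, Gf s y = Gf' s y) (s : ℝ) (k : ℕ) (hx : x ∈ U) :
    tnormSq (Gf s) b (curvD Gf b k s) x = tnormSq (Gf' s) b (curvD Gf' b k s) x := by
  simp only [tnormSq_eq, tinner_apply, curvD_congr_of_eqOn hU h s k x hx, ginv, h s x hx, sharpAt]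

end Local

end MetricCoord

end Literature.Geometry.Lorentzian

end
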